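import Summits.BirchSwinnertonDyer.BirchSwinnertonDyer.Theorems.PrintCf2SplitBadTwoRestrictedSelmerCoinvariantsVanish
import Summits.BirchSwinnertonDyer.BirchSwinnertonDyer.Theorems.PrintCf2SplitBadTwoRestrictedSelmerPairBase
import HarnessLib

/-!
# Crux `PrintCf2.SplitBadTwoRankOneOfFacts` (stmt-BirchSwinnertonDyer-20368), road α v9.1 — S3c₂ piece (iv)-a:
# THE COKERNEL OF CONTROL IS BOUNDED BY THE PRODUCT OF THE LOCAL KERNELS (generic), so `[𝔖^Γ : res 𝔖_𝔮(K, M)] ≤ ∏_w #LK_w`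

Cell `bsd-print-cf2`, LEAD seat `bsd-line-cf2-p1` g11 (prover-bsd-line-cf2-p1-g11-0); `--supports stmt-BirchSwinnertonDyer-20368` (helper,
Theses-free). HONEST FRAMING: nothing here closes the crux or a registered stub; BSD is not proved by any of this; no summit statement is
proved by this seat. No definition, no named fact, no `sorry`.

-w7's four-index identity (p652120) for the registered stub S3c₂ `stub_restrictedEulerCharBottom_two` carries the COKERNEL index
`[𝔖_𝔮(K_∞, M)^Γ : res 𝔖_𝔮(K, M)]`; -w7's B5′ (`resOfLe_local_lift_eq_zero`, `control_surjective_of_local`) showed the obstruction is LOCAL.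
This file makes that QUANTITATIVE, for ANY number field `K`, `ℤ_p`-line `κ` with generator `γ`, discrete `p`-primary `M` with continuous
orbit maps, place `𝔮`: writing `LK_w := ker (H¹(D_w, M) → H¹(D_w ∩ Gal(K̄/K_∞), M))` for the LOCAL KERNEL at a place `w` (the chosen
decomposition group `GreenbergSelmer.decomp w`; `decompInf` at infinity),
* `resOfLe_decomp_mem_localKer_of_mem` — the local classes of any `x ∈ H¹(K, M)` whose restriction lies in `𝔖_𝔮(K_∞, M)` lie in the
  local kernels (B5′ at the bottom, `σ`-free);
* `mem_restrictedSelmerBase_iff_of_localKer_eq_bot` — if the local kernels VANISH at every finite `w ∤ p` outside a finite set `T` and at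
  every infinite place, such an `x` lies in `𝔖_𝔮(K, M)` iff its local classes at `w ∈ T` and at `𝔮` vanish;
* `exists_resOfLe_top_eq_of_mem_endInvariants` — every `Γ`-invariant class of `𝔖_𝔮(K_∞, M)` lifts to `H¹(K, M)` (Greenberg Lemma 3.2,
  `cd_p Γ = 1`, transported to `H = ⊤`);
* **`relIndex_le_prod_natCard_localKer`** — `[𝔖^Γ : res 𝔖_𝔮(K, M)] ≤ (∏_{w ∈ T} #LK_w) · #LK_𝔮` whenever these local kernels are finite:
  the lifts form a subgroup `A ≤ H¹(K, M)` mapping ONTO `𝔖^Γ`; `𝔖_𝔮(K, M) = A ∩ ker(local classes)`, so `A/𝔖_𝔮(K, M) ↪ ∏ LK_w`, and the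
  index of an image under a surjection divides the index (`AddSubgroup.index_map_dvd`).
ROAD α reading: `K = ℚ(√−7)` (no real place ⇒ `LK_∞ = 0` trivially: `D_∞` is the image of `Γ_ℂ = 1`), `T` = the places above `7d` (at a
good `w ∤ 2·7d` the local kernel vanishes: `Frob_w − 1` is onto the divisible unramified `W*` — brick B16, -w3 g7), `LK_w` at `w ∣ 7d` finite
`≤ #W*^{I_w} ≤ 4` (p656082's engine), and `LK_{v̄}` (strict place) is the dyadic term (B15): so the cokernel term of S3c₂ is
`≤ ∑_{w ∣ 7d} v₂ #LK_w + v₂ #LK_{v̄}` — class-uniform except at `v̄`.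
presearch: Greenberg LNM 1716 §3 (the maps `r_v`, Lemma 3.2–3.3); Agboola 2007 Prop. 3.2 — held; no fact filed.

References: [GreenbergLNM1716] §3 Lemmas 3.2–3.3 (pp. 86–88); [Agboola2007] §3 Prop. 3.2 (arXiv p0008:L128–135, L197).
-/

noncomputable section

open scoped Classical

set_option linter.dupNamespace false
set_option autoImplicit false

open NumberField IsDedekindDomain Field
open Literature.NumberTheory.EllipticCurves Literature.NumberTheory.EllipticCurves.GreenbergSelmer
open Literature.NumberTheory.EllipticCurves.Agboola2007
open Literature.NumberTheory.EllipticCurves.IwasawaDual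
open Literature.NumberTheory.EllipticCurves.ResKernel
open Literature.NumberTheory.GaloisRepresentations

universe u

namespace Summit.BirchSwinnertonDyer.BirchSwinnertonDyer.Theorems.PrintCf2.RestrictedSelmerPair

section Coker

variable {K : Type u} [Field K] [NumberField K] {p : ℕ} [Fact p.Prime] (κ : ZpExtension K p)
  (M : Type u) [AddCommGroup M] [DistribMulAction (absoluteGaloisGroup K) M]
  [TopologicalSpace M] [DiscreteTopology M] (𝔮 : HeightOneSpectrum (𝓞 K))

/-- **Local classes of a class restricting into `𝔖_𝔮(K_∞, M)` lie in the local kernels** (B5′ at the bottom, `σ`-free: at `H = ⊤` the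
conjugations are trivial): for `x ∈ H¹(K, M)` with `res x ∈ 𝔖_𝔮(K_∞, M)`, `loc_w x ∈ LK_w := ker (H¹(⊤ ∩ D_w, M) → H¹(Gal(K̄/K_∞) ∩ D_w, M))`
at every finite `w ∤ p`, at `𝔮`, and at every infinite place. [cite: Agboola2007, §3 Prop. 3.2 (arXiv p0008:L197)]
[cite: GreenbergLNM1716, §3 (the maps `r_v`, p. 86)] -/
theorem resOfLe_decomp_mem_localKer_of_mem {x : subgroupH1 (⊤ : Subgroup (absoluteGaloisGroup K)) M}
    (hx : resOfLe M (le_top : κ.kerSubgroup ≤ ⊤) x ∈ restrictedSelmerZp κ M 𝔮) :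
    (∀ w : HeightOneSpectrum (𝓞 K), ((p : ℕ) : 𝓞 K) ∉ w.asIdeal →
        resOfLe M (inf_le_left : ⊤ ⊓ decomp w ≤ ⊤) x ∈
          (resOfLe M (inf_le_inf_right (decomp w) (le_top : κ.kerSubgroup ≤ ⊤))).ker) ∧
      (∀ w : InfinitePlace K,
        resOfLe M (inf_le_left : ⊤ ⊓ decompInf w ≤ ⊤) x ∈
          (resOfLe M (inf_le_inf_right (decompInf w) (le_top : κ.kerSubgroup ≤ ⊤))).ker) ∧
      resOfLe M (inf_le_left : ⊤ ⊓ decomp 𝔮 ≤ ⊤) x ∈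
        (resOfLe M (inf_le_inf_right (decomp 𝔮) (le_top : κ.kerSubgroup ≤ ⊤))).ker := by
  have h := (mem_restrictedSelmer_iff_resOfLe κ.kerSubgroup M p 𝔮 _).1 hx
  have h1 : conjH1 κ.kerSubgroup M 1 (resOfLe M (le_top : κ.kerSubgroup ≤ ⊤) x) = resOfLe M le_top x := by
    rw [conjH1_one_holds, AddMonoidHom.id_apply]
  refine ⟨fun w hw ↦ ?_, fun w ↦ ?_, ?_⟩
  · have hh := h.1 w hw 1
    rw [h1, resOfLe_inf_resOfLe M (le_top : κ.kerSubgroup ≤ ⊤)] at hh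
    exact (AddMonoidHom.mem_ker).mpr hh
  · have hh := h.2.1 w 1
    rw [h1, resOfLe_inf_resOfLe M (le_top : κ.kerSubgroup ≤ ⊤)] at hh
    exact (AddMonoidHom.mem_ker).mpr hh
  · have hh := h.2.2 1
    rw [h1, resOfLe_inf_resOfLe M (le_top : κ.kerSubgroup ≤ ⊤)] at hh
    exact (AddMonoidHom.mem_ker).mpr hh

/-- **If the local kernels vanish off a finite set `T` of finite places prime to `p` and at infinity**, a class `x ∈ H¹(K, M)` restricting
into `𝔖_𝔮(K_∞, M)` lies in `𝔖_𝔮(K, M)` iff its local classes at `w ∈ T` and at `𝔮` vanish (`mem_restrictedSelmerBase_iff_resOfLe` + §1).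
[cite: Agboola2007, §3 Prop. 3.2] [cite: GreenbergLNM1716, §3 Lemma 3.3 (ker r_v = 0 at almost all v)] -/
theorem mem_restrictedSelmerBase_iff_of_localKer_eq_bot (T : Finset (HeightOneSpectrum (𝓞 K)))
    (hT0 : ∀ w : HeightOneSpectrum (𝓞 K), ((p : ℕ) : 𝓞 K) ∉ w.asIdeal → w ∉ T →
      (resOfLe M (inf_le_inf_right (decomp w) (le_top : κ.kerSubgroup ≤ ⊤))).ker = ⊥)
    (hinf : ∀ w : InfinitePlace K, (resOfLe M (inf_le_inf_right (decompInf w) (le_top : κ.kerSubgroup ≤ ⊤))).ker = ⊥)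
    {x : subgroupH1 (⊤ : Subgroup (absoluteGaloisGroup K)) M}
    (hx : resOfLe M (le_top : κ.kerSubgroup ≤ ⊤) x ∈ restrictedSelmerZp κ M 𝔮) :
    x ∈ restrictedSelmerBase M p 𝔮 ↔
      (∀ w ∈ T, ((p : ℕ) : 𝓞 K) ∉ w.asIdeal → resOfLe M (inf_le_left : ⊤ ⊓ decomp w ≤ ⊤) x = 0) ∧
        resOfLe M (inf_le_left : ⊤ ⊓ decomp 𝔮 ≤ ⊤) x = 0 := by
  obtain ⟨hf, hi, hq⟩ := resOfLe_decomp_mem_localKer_of_mem κ M 𝔮 hx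
  rw [mem_restrictedSelmerBase_iff_resOfLe M p 𝔮 x]
  constructor
  · rintro ⟨h1, -, h3⟩
    exact ⟨fun w _ hw ↦ h1 w hw, h3⟩
  · rintro ⟨h1, h3⟩
    refine ⟨fun w hw ↦ ?_, fun w ↦ ?_, h3⟩
    · by_cases hwT : w ∈ T
      · exact h1 w hwT hw
      · have hm := hf w hw
        rw [hT0 w hw hwT, AddSubgroup.mem_bot] at hm
        exact hm
    · have hm := hi w
      rw [hinf w, AddSubgroup.mem_bot] at hm
      exact hm

/-- **Every `Γ`-invariant class of `𝔖_𝔮(K_∞, M)` lifts to `H¹(K, M)`** (`M` `p`-primary with continuous orbit maps, `γ` a topological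
generator): Greenberg's Lemma 3.2 (`exists_resOfLe_eq_of_conjH1_eq` at layer `0`) transported along `H¹(⊤, M) ≅ H¹(H_0, M)`.
[cite: GreenbergLNM1716, §3 Lemma 3.2 (p. 86)] -/
theorem exists_resOfLe_top_eq_of_mem_endInvariants {γ : absoluteGaloisGroup K} (hγ : κ.IsTopGenerator γ)
    (hcont : ∀ m : M, Continuous fun g : absoluteGaloisGroup K ↦ g • m) (hprim : ∀ m : M, ∃ k : ℕ, p ^ k • m = 0)
    {y : restrictedSelmerZp κ M 𝔮} (hy : y ∈ endInvariants (conjRestricted κ M 𝔮 γ - 1)) :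
    ∃ x : subgroupH1 (⊤ : Subgroup (absoluteGaloisGroup K)) M,
      resOfLe M (le_top : κ.kerSubgroup ≤ ⊤) x = (y : subgroupH1 κ.kerSubgroup M) := by
  have hy' : conjH1 κ.kerSubgroup M (γ ^ p ^ 0) (y : subgroupH1 κ.kerSubgroup M) = y := by
    rw [pow_zero, pow_one]
    exact (mem_endInvariants_conjRestricted_iff y).1 hy
  obtain ⟨x₀, hx₀⟩ := exists_resOfLe_eq_of_conjH1_eq κ M 0 hγ hcont hprim (y : subgroupH1 κ.kerSubgroup M) hy'
  refine ⟨resOfLe M (le_of_eq (ZpExtension.layerSubgroup_zero κ).symm) x₀, ?_⟩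
  rw [← AddMonoidHom.comp_apply, Literature.NumberTheory.EllipticCurves.resOfLe_comp_holds]
  exact hx₀

/-- **THE COKERNEL OF CONTROL IS BOUNDED BY THE PRODUCT OF THE LOCAL KERNELS.** For a `ℤ_p`-line `κ` of a number field `K` with
topological generator `γ`, a discrete `p`-primary `Γ_K`-module `M` with continuous orbit maps, a place `𝔮`, and a finite set `T` of finite
places prime to `p` such that the local kernels `LK_w = ker (H¹(D_w, M) → H¹(D_w ∩ Gal(K̄/K_∞), M))` VANISH at every finite `w ∤ p` outside `T`
and at every infinite place and are FINITE at `w ∈ T` and at `𝔮`: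
`[𝔖_𝔮(K_∞, M)^Γ : res 𝔖_𝔮(K, M)] ≤ (∏_{w ∈ T} #LK_w) · #LK_𝔮`.
[cite: GreenbergLNM1716, §3 Lemmas 3.2–3.3 (pp. 86–88)] [cite: Agboola2007, §3 Prop. 3.2 (arXiv p0008:L128–135, L197)] -/
theorem relIndex_le_prod_natCard_localKer {γ : absoluteGaloisGroup K} (hγ : κ.IsTopGenerator γ)
    (hcont : ∀ m : M, Continuous fun g : absoluteGaloisGroup K ↦ g • m) (hprim : ∀ m : M, ∃ k : ℕ, p ^ k • m = 0)
    (T : Finset (HeightOneSpectrum (𝓞 K))) (hTp : ∀ w ∈ T, ((p : ℕ) : 𝓞 K) ∉ w.asIdeal)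
    (hT0 : ∀ w : HeightOneSpectrum (𝓞 K), ((p : ℕ) : 𝓞 K) ∉ w.asIdeal → w ∉ T →
      (resOfLe M (inf_le_inf_right (decomp w) (le_top : κ.kerSubgroup ≤ ⊤))).ker = ⊥)
    (hinf : ∀ w : InfinitePlace K, (resOfLe M (inf_le_inf_right (decompInf w) (le_top : κ.kerSubgroup ≤ ⊤))).ker = ⊥)
    (hfinT : ∀ w ∈ T, Finite (resOfLe M (inf_le_inf_right (decomp w) (le_top : κ.kerSubgroup ≤ ⊤))).ker)
    (hfinq : Finite (resOfLe M (inf_le_inf_right (decomp 𝔮) (le_top : κ.kerSubgroup ≤ ⊤))).ker) :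
    (((restrictedSelmerBase M p 𝔮).map (resOfLe M (le_top : κ.kerSubgroup ≤ ⊤))).addSubgroupOf
        (restrictedSelmerZp κ M 𝔮)).relIndex (endInvariants (conjRestricted κ M 𝔮 γ - 1)) ≤
      (∏ w ∈ T, Nat.card (resOfLe M (inf_le_inf_right (decomp w) (le_top : κ.kerSubgroup ≤ ⊤))).ker) *
        Nat.card (resOfLe M (inf_le_inf_right (decomp 𝔮) (le_top : κ.kerSubgroup ≤ ⊤))).ker := by
  -- notation
  set H := κ.kerSubgroup with hHdef
  set f : subgroupH1 (⊤ : Subgroup (absoluteGaloisGroup K)) M →+ subgroupH1 H M := resOfLe M (le_top : H ≤ ⊤) with hfdef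
  set S := restrictedSelmerZp κ M 𝔮 with hSdef
  set E : AddSubgroup S := endInvariants (conjRestricted κ M 𝔮 γ - 1) with hEdef
  set SK := restrictedSelmerBase M p 𝔮 with hSKdef
  -- the subgroup `A` of lifts of invariant classes: `A = f⁻¹(E)`
  set A : AddSubgroup (subgroupH1 (⊤ : Subgroup (absoluteGaloisGroup K)) M) := (E.map S.subtype).comap f with hAdef
  have hAS : ∀ x ∈ A, f x ∈ S := by
    rintro x ⟨e, -, hex⟩
    rw [← hex]; exact e.2
  have hAE : ∀ (x) (hx : x ∈ A), (⟨f x, hAS x hx⟩ : S) ∈ E := by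
    rintro x hx
    obtain ⟨e, he, hex⟩ := hx
    have : (⟨f x, hAS x ⟨e, he, hex⟩⟩ : S) = e := Subtype.ext hex.symm
    rw [this]; exact he
  have hmemA : ∀ (x) (hS : f x ∈ S), (⟨f x, hS⟩ : S) ∈ E → x ∈ A := fun x hS hE ↦ ⟨⟨f x, hS⟩, hE, rfl⟩
  -- `SK ≤ A`
  have hSKA : SK ≤ A := by
    intro c hc
    refine hmemA c (resOfLe_mem_restrictedSelmer M p 𝔮 le_top hc) ?_
    rw [hEdef, mem_endInvariants_conjRestricted_iff]
    exact conjH1_resOfLe_of_mem M (le_top : H ≤ ⊤) (Subgroup.mem_top γ) c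
  -- the map `g : A → E`, onto
  let g : A →+ E :=
    { toFun := fun x ↦ ⟨⟨f x, hAS x x.2⟩, hAE x x.2⟩
      map_zero' := Subtype.ext (Subtype.ext (by simp only [ZeroMemClass.coe_zero, map_zero]))
      map_add' := fun a b ↦ Subtype.ext (Subtype.ext (by simp only [AddSubgroup.coe_add, map_add])) }
  have hg : Function.Surjective g := by
    intro y
    obtain ⟨x, hx⟩ := exists_resOfLe_top_eq_of_mem_endInvariants κ M 𝔮 hγ hcont hprim (y := (y : S)) y.2
    have hxS : f x ∈ S := by rw [hfdef, hx]; exact (y : S).2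
    have hxA : x ∈ A := hmemA x hxS (by
      have : (⟨f x, hxS⟩ : S) = (y : S) := Subtype.ext hx
      rw [this]; exact y.2)
    exact ⟨⟨x, hxA⟩, Subtype.ext (Subtype.ext hx)⟩
  -- `B := SK` inside `A`, and its image under `g` lies in the image of `SK` inside `E`
  set B : AddSubgroup A := SK.addSubgroupOf A with hBdef
  have hBg : B.map g ≤ ((SK.map f).addSubgroupOf S).addSubgroupOf E := by
    rintro _ ⟨x, hxB, rfl⟩
    rw [AddSubgroup.mem_addSubgroupOf, AddSubgroup.mem_addSubgroupOf]
    exact ⟨(x : subgroupH1 ⊤ M), AddSubgroup.mem_addSubgroupOf.mp hxB, rfl⟩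
  -- the local-class map `φ : A → (∏_{w ∈ T} LK_w) × LK_𝔮`, kernel `B`
  let LK : (w : HeightOneSpectrum (𝓞 K)) →
      AddSubgroup (subgroupH1 ((⊤ : Subgroup (absoluteGaloisGroup K)) ⊓ decomp w) M) := fun w ↦
    (resOfLe M (inf_le_inf_right (decomp w) (le_top : H ≤ ⊤))).ker
  have hloc : ∀ (x : A) (w : HeightOneSpectrum (𝓞 K)), ((p : ℕ) : 𝓞 K) ∉ w.asIdeal ∨ w = 𝔮 →
      resOfLe M (inf_le_left : ⊤ ⊓ decomp w ≤ ⊤) (x : subgroupH1 ⊤ M) ∈ LK w := by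
    intro x w hw
    obtain ⟨hfin', -, hq⟩ := resOfLe_decomp_mem_localKer_of_mem κ M 𝔮 (hAS x x.2)
    rcases hw with hw | rfl
    · exact hfin' w hw
    · exact hq
  let G := subgroupH1 (⊤ : Subgroup (absoluteGaloisGroup K)) M
  let locw : (w : HeightOneSpectrum (𝓞 K)) →
      (G →+ subgroupH1 ((⊤ : Subgroup (absoluteGaloisGroup K)) ⊓ decomp w) M) := fun w ↦
    resOfLe M (inf_le_left : ⊤ ⊓ decomp w ≤ ⊤)
  let φ : A →+ (Π w : ↥T, LK (w : HeightOneSpectrum (𝓞 K))) × LK 𝔮 :=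
    { toFun := fun x ↦ (fun w ↦ ⟨locw w (x : G), hloc x w (Or.inl (hTp w w.2))⟩, ⟨locw 𝔮 (x : G), hloc x 𝔮 (Or.inr rfl)⟩)
      map_zero' := by
        refine Prod.ext (funext fun w ↦ Subtype.ext ?_) (Subtype.ext ?_)
        · show locw w ((0 : A) : G) = ((0 : LK (w : HeightOneSpectrum (𝓞 K))) :
            subgroupH1 ((⊤ : Subgroup (absoluteGaloisGroup K)) ⊓ decomp (w : HeightOneSpectrum (𝓞 K))) M)
          rw [ZeroMemClass.coe_zero, map_zero, ZeroMemClass.coe_zero]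
        · show locw 𝔮 ((0 : A) : G) = ((0 : LK 𝔮) : subgroupH1 ((⊤ : Subgroup (absoluteGaloisGroup K)) ⊓ decomp 𝔮) M)
          rw [ZeroMemClass.coe_zero, map_zero, ZeroMemClass.coe_zero]
      map_add' := fun a b ↦ by
        refine Prod.ext (funext fun w ↦ Subtype.ext ?_) (Subtype.ext ?_)
        · show locw w ((a : G) + (b : G)) = locw w (a : G) + locw w (b : G)
          exact map_add _ _ _
        · show locw 𝔮 ((a : G) + (b : G)) = locw 𝔮 (a : G) + locw 𝔮 (b : G)
          exact map_add _ _ _ }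
  have hφ1 : ∀ (x : A) (w : ↥T), (((φ x).1 w : LK (w : HeightOneSpectrum (𝓞 K))) :
      subgroupH1 ((⊤ : Subgroup (absoluteGaloisGroup K)) ⊓ decomp (w : HeightOneSpectrum (𝓞 K))) M) =
      resOfLe M (inf_le_left : ⊤ ⊓ decomp (w : HeightOneSpectrum (𝓞 K)) ≤ ⊤) (x : G) := fun _ _ ↦ rfl
  have hφ2 : ∀ x : A, (((φ x).2 : LK 𝔮) : subgroupH1 ((⊤ : Subgroup (absoluteGaloisGroup K)) ⊓ decomp 𝔮) M) =
      resOfLe M (inf_le_left : ⊤ ⊓ decomp 𝔮 ≤ ⊤) (x : G) := fun _ ↦ rfl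
  have hkerφ : φ.ker = B := by
    ext x
    rw [AddMonoidHom.mem_ker, hBdef, AddSubgroup.mem_addSubgroupOf,
      mem_restrictedSelmerBase_iff_of_localKer_eq_bot κ M 𝔮 T hT0 hinf (hAS x x.2)]
    constructor
    · intro h0
      refine ⟨fun w hwT _ ↦ ?_, ?_⟩
      · rw [← hφ1 x ⟨w, hwT⟩, h0]; rfl
      · rw [← hφ2 x, h0]; rfl
    · rintro ⟨h1, h2⟩
      refine Prod.ext (funext fun w ↦ Subtype.ext ?_) (Subtype.ext ?_)
      · rw [hφ1]; exact h1 w w.2 (hTp w w.2)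
      · rw [hφ2]; exact h2
  -- counting
  haveI hfinP : Finite ((Π w : ↥T, LK (w : HeightOneSpectrum (𝓞 K))) × LK 𝔮) := by
    haveI : ∀ w : ↥T, Finite (LK (w : HeightOneSpectrum (𝓞 K))) := fun w ↦ hfinT w w.2
    haveI := hfinq
    infer_instance
  have hcardP : Nat.card ((Π w : ↥T, LK (w : HeightOneSpectrum (𝓞 K))) × LK 𝔮) =
      (∏ w ∈ T, Nat.card (LK w)) * Nat.card (LK 𝔮) := by
    rw [Nat.card_prod, Nat.card_pi, ← Finset.prod_coe_sort T (fun w ↦ Nat.card (LK w))]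
  -- `B.index = #(A/B) = #range φ ≤ #P`
  have hidx : B.index = Nat.card φ.range := by
    rw [AddSubgroup.index_eq_card, ← hkerφ]
    exact Nat.card_congr (QuotientAddGroup.quotientKerEquivRange φ).toEquiv
  have hBidx : B.index ≤ (∏ w ∈ T, Nat.card (LK w)) * Nat.card (LK 𝔮) := by
    rw [hidx, ← hcardP]
    exact Nat.card_le_card_of_injective _ Subtype.val_injective
  have hBidx0 : B.index ≠ 0 := by
    rw [hidx]
    haveI : Finite φ.range := Finite.of_injective _ Subtype.val_injective
    haveI : Nonempty φ.range := ⟨0⟩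
    exact (Nat.card_pos (α := ↥φ.range)).ne'
  -- `(B.map g).index ∣ B.index`
  have hdvd : (B.map g).index ∣ B.index := AddSubgroup.index_map_dvd B hg
  have hmap0 : (B.map g).index ≠ 0 := fun h0 ↦ hBidx0 (Nat.eq_zero_of_zero_dvd (h0 ▸ hdvd))
  haveI : (B.map g).FiniteIndex := ⟨hmap0⟩
  -- the relative index is the index of a larger subgroup of `E`
  have hrel : (((SK.map f).addSubgroupOf S).relIndex E) = (((SK.map f).addSubgroupOf S).addSubgroupOf E).index := rfl
  rw [hrel]
  calc (((SK.map f).addSubgroupOf S).addSubgroupOf E).index ≤ (B.map g).index := AddSubgroup.index_antitone hBg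
    _ ≤ B.index := Nat.le_of_dvd (Nat.pos_of_ne_zero hBidx0) hdvd
    _ ≤ _ := hBidx

end Coker

end Summit.BirchSwinnertonDyer.BirchSwinnertonDyer.Theorems.PrintCf2.RestrictedSelmerPair

end
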